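import Literature.Barriers.CriticalPhenomena.SupercriticalSAWSpaceFillingFilamentsCusp
import HarnessLib

/-!
# Supercritical self-avoiding walks (Duminil-Copin–Kozma–Yadin 2014): the printed general-domain
# Theorem 6 fails for the cusp domain even in its charitable reading (`a ≠ b`, `δ < δ₀(a, b)`)

Companion of `SupercriticalSAWSpaceFillingFilamentsCusp.lean` (barrier audit of 2026-08-15), which
refutes, for the disk with an outward cusp `Ω = cuspDomain`, the displayed bound of Theorem 6 of
H. Duminil-Copin, G. Kozma, A. Yadin, *Supercritical self-avoiding walks are space-filling*,
Ann. IHP Probab. Stat. 50 (2014) 315–326, arXiv:1110.3074, §3 p. 6 ("for every domain `Ω` and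
every `δ > 0` such that `𝓕(Ω_δ, m)` is connected, one has, for every `a` and `b` in the boundary
of `Ω`, and every `λ > 0`, `P(…) ≤ (C(x,Ω)/δ²) e^{-c(x)λ}`") read literally
(`not_DKY2014_thm6_print_cuspDomain`). The vendored disk instance `DKY2014_thm6_disk`
(`SupercriticalSAWSpaceFillingSteps.lean`) reads the print charitably — `a ≠ b` explicit and the
mesh restricted to `0 < δ < δ₀(x, a, b)` — because for `a_δ = b_δ` the printed bound is
trivially false. This file checks that the charitable reading does not rescue the general-domain
statement either: `not_DKY2014_thm6_print_cuspDomain'` has exactly the quantifier shape of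
`DKY2014_thm6_disk` (with `Ω = cuspDomain`, boundary points of `Ω`, and the box-family
hypothesis of Theorem 6 at each mesh) and is refuted by the same deterministic filament hole at
`δ = 1/t² < δ₀(i, -i)`, `λ = t`. Theorem 1 and the disk instance (both proved in the tree) are
not affected.

## References

* H. Duminil-Copin, G. Kozma, A. Yadin, Ann. Inst. Henri Poincaré Probab. Stat. 50 (2014)
  315–326, arXiv:1110.3074: §3 p. 6 (Theorem 6). [DuminilCopinKozmaYadin2014]
-/

noncomputable section

open MeasureTheory Filter Topology Literature.Probability.LatticeModels Literature.Probability.Percolation Literature.Probability.RandomPlanarGeometry.SAW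
open scoped ENNReal NNReal

namespace Literature.Barriers.CriticalPhenomena

namespace SupercriticalSAW

/-- **The charitable reading fails too.** Even with `a ≠ b` explicit and the mesh restricted to
`0 < δ < δ₀(a, b)` — the quantifier shape of the vendored disk instance `DKY2014_thm6_disk` —
the displayed bound of the printed general-domain Theorem 6 fails for the cusp domain, for
every `x > 0` and every constant tube radius `ξ ≥ 0`. [cite: DuminilCopinKozmaYadin2014, Theorem 6] -/
theorem not_DKY2014_thm6_print_cuspDomain' {x : ℝ} (hx : 0 < x) :
    ¬ ∃ m : ℕ, ∃ ξ : ℝ, 0 ≤ ξ ∧ ∃ c : ℝ, 0 < c ∧ ∃ C : ℝ,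
      ∀ a b : ℂ, a ∈ frontier cuspDomain → b ∈ frontier cuspDomain → a ≠ b →
      ∃ δ₀ : ℝ, 0 < δ₀ ∧ ∀ δ : ℝ, 0 < δ → δ < δ₀ →
      ((zdGraph 2).induce (boxFamily cuspDomain δ m)).Preconnected →
      ∀ u v : Site 2, IsClosestSite cuspDomain δ a u → IsClosestSite cuspDomain δ b v →
      ∀ s : ℝ, 0 < s →
        lawAt x cuspDomain δ u v {γ | HasLargeHole ξ s γ} ≤
          ENNReal.ofReal (C / δ ^ 2 * Real.exp (-(c * s))) := by
  rintro ⟨m, ξ, hξ, c, hc, C, H⟩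
  have hI : ‖(Complex.I : ℂ)‖ = 1 := Complex.norm_I
  have hnI : ‖(-Complex.I : ℂ)‖ = 1 := by rw [norm_neg, Complex.norm_I]
  have hne : (Complex.I : ℂ) ≠ -Complex.I := fun h => by
    have := congrArg Complex.im h; norm_num at this
  obtain ⟨δ₀, hδ₀, H⟩ := H Complex.I (-Complex.I) (mem_frontier_cuspDomain hI (by simp))
    (mem_frontier_cuspDomain hnI (by simp)) hne
  -- the tube radius, rounded up (and at least `1`)
  set M : ℕ := max 1 ⌈ξ⌉₊ with hM
  have hM1 : 1 ≤ M := le_max_left _ _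
  have hξM : ξ ≤ M := (Nat.le_ceil ξ).trans (by rw [hM]; exact_mod_cast le_max_right _ _)
  -- a large `t`, `δ = 1/t² < δ₀`
  obtain ⟨T, hT⟩ := Filter.eventually_atTop.1 (eventually_bound_lt_one hc C)
  set t : ℝ := max (max T (1 / Real.sqrt δ₀ + 1))
    (max (Real.sqrt 20) (max (2 * Real.sqrt ((m : ℝ) + 1)) ((M : ℝ) / 2 + 1))) with ht
  have htT : T ≤ t := (le_max_left _ _).trans (le_max_left _ _)
  have htδ₀ : 1 / Real.sqrt δ₀ + 1 ≤ t := (le_max_right _ _).trans (le_max_left _ _)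
  have ht20 : Real.sqrt 20 ≤ t := (le_max_left _ _).trans (le_max_right _ _)
  have htm : 2 * Real.sqrt ((m : ℝ) + 1) ≤ t := ((le_max_left _ _).trans (le_max_right _ _)).trans (le_max_right _ _)
  have htM : (M : ℝ) / 2 + 1 ≤ t := ((le_max_right _ _).trans (le_max_right _ _)).trans (le_max_right _ _)
  have ht0 : 0 < t := lt_of_lt_of_le (Real.sqrt_pos.2 (by norm_num)) ht20
  set δ : ℝ := 1 / t ^ 2 with hδ
  have hδ0 : 0 < δ := by positivity
  have hsqrt : Real.sqrt δ = 1 / t := by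
    rw [hδ, Real.sqrt_div' _ , Real.sqrt_one, Real.sqrt_sq ht0.le]
    exact sq_nonneg _
  have hst : 1 / Real.sqrt δ = t := by rw [hsqrt, one_div_one_div]
  have htδ : t ^ 2 * δ = 1 := by rw [hδ]; field_simp
  -- `δ < δ₀`
  have hδlt : δ < δ₀ := by
    have hs0 : 0 < Real.sqrt δ₀ := Real.sqrt_pos.2 hδ₀
    have h1 : 1 / Real.sqrt δ₀ < t := by linarith
    have h2 : 1 < t * Real.sqrt δ₀ := by rwa [div_lt_iff₀ hs0] at h1
    have h3 : 1 < t ^ 2 * δ₀ := by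
      have := mul_pow t (Real.sqrt δ₀) 2
      rw [Real.sq_sqrt hδ₀.le] at this
      rw [← this]; nlinarith
    rw [hδ, div_lt_iff₀ (by positivity)]; linarith
  -- the smallness conditions on `δ`
  have hδ20 : δ ≤ 1 / 20 := by
    rw [hδ, div_le_div_iff₀ (by positivity) (by norm_num), one_mul, one_mul]
    have h := Real.sq_sqrt (show (0 : ℝ) ≤ 20 by norm_num)
    nlinarith [Real.sqrt_nonneg 20]
  have hδm : 4 * ((m : ℝ) + 1) * δ ≤ 1 := by
    have h := Real.sq_sqrt (show (0 : ℝ) ≤ (m : ℝ) + 1 by positivity)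
    have h2 : 4 * ((m : ℝ) + 1) ≤ t ^ 2 := by nlinarith [Real.sqrt_nonneg ((m : ℝ) + 1)]
    calc 4 * ((m : ℝ) + 1) * δ ≤ t ^ 2 * δ := mul_le_mul_of_nonneg_right h2 hδ0.le
      _ = 1 := htδ
  have hδM : δ * (M : ℝ) ^ 2 ≤ 4 := by
    have h2 : (M : ℝ) ^ 2 ≤ 4 * t ^ 2 := by nlinarith
    calc δ * (M : ℝ) ^ 2 ≤ δ * (4 * t ^ 2) := mul_le_mul_of_nonneg_left h2 hδ0.le
      _ = 4 := by rw [hδ]; field_simp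
  -- closest sites, the event, the bound
  obtain ⟨u, hu⟩ := exists_isClosestSite_cuspDomain hδ0 Complex.I
  obtain ⟨v, hv⟩ := exists_isClosestSite_cuspDomain hδ0 (-Complex.I)
  have hevent : {γ : DomainSAW cuspDomain δ u v | HasLargeHole ξ (1 / Real.sqrt δ) γ} = Set.univ :=
    Set.eq_univ_of_forall fun γ => hasLargeHole_cuspDomain M hM1 hξM hδ0 hδ20 hδM hI hnI hu hv γ
  have hP := H δ hδ0 hδlt (boxFamily_cuspDomain_preconnected hδ0 hδm) u v hu hv
    (1 / Real.sqrt δ) (by positivity)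
  rw [hevent, lawAt_cuspDomain_univ hx hδ0 hu.1 hv.1, hst] at hP
  have hlt := hT t htT
  have hC : C / δ ^ 2 = C * t ^ 4 := by rw [hδ]; field_simp
  rw [hC] at hP
  have := ENNReal.one_le_ofReal.1 hP
  linarith


end SupercriticalSAW

end Literature.Barriers.CriticalPhenomena
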